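import Literature.MathematicalPhysics.QuantumFieldTheory.Balaban1983to89.B3Cor23ConcreteProof

/-!
# `Balaban1983to89.B3DivergentGraphs` — T. Bałaban, *(Higgs)₂,₃ quantum fields in a finite volume. III. Renormalization*,
Commun. Math. Phys. **88** (1983) 411–445 [Balaban1983Higgs3]: the counting of the divergent graphs by their external legs,
pp. 429–431 (after Corollary 2.3), DECIDED on the concrete family of graphs `B3Cor23Concrete.Graph`

statement-level skeleton of published theorems with citation tags; proofs where landed; nothing here is a claim about the Yang–Mills mass gap

PDF held: `paper:balaban1983-higgs-2-3-quantum-fields-finite-volume` (journal page = PDF page + 410); renders read as images: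
`…/b2b-balaban-ref1/pages/1983-cmp88-higgs23-III/1983-cmp88-higgs23-III-p013, p019, p020-x2.png` (pp. 423, 429, 430).
CITATION HEADER (lean-in-tree rule).  lit-balaban TYPED SKELETON (HOME `run/shared/lean/pub/lit-balaban/`), Phase 2, seat p18
(gen 2), unit `lit-balaban-p18`: SKELETON rows **B3.Txt@430** (p. 430: *"The estimate (2.17) implies that we can have such graphs
with at most four vertices"*, twice) and the counting half of **B3.Eq2.18-2.22** (p. 429: divergent graphs *"can be built of the
vertices (1.6)–(1.8) and (1.10) only"*; four / three external legs); siblings `…B3ScalarLegParity` (row B3.Txt@431) and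
`…B3Graph24Unique` (p. 429 *"only one graph with four external legs"*).  The model (`B3Cor23Concrete`, seat p18 gen 1): graphs of admissible catalogue vertices (1.6)–(1.15), internal lines as
the pairing «other endpoint» of φ′/A′-legs, mass renormalization vertices in the attached form of p. 423, D(G) = (2.2).

WHAT THIS MODULE PROVES (sorry-free; four `def`s with bodies = leg counts; no `Prop` fact introduced).
(1) Bookkeeping of (2.1)/(2.2) (`vertexDeg_eq_degree_add`, `deg_eq_sum`, every d): for a vertex not of the form (1.14)–(1.15),
D_G(v) = D(v) + (external φ′/A′-legs of v)·(d−2)/2 + (differentiations of v acting on external legs), D(v) the all-internal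
degree of p. 423 (table (i)–(v)); the legs of the external field Ã enter through D(v) (η-powers n′).
(2) d = 3 (`degree_three_ge`, `eq_v18_of_degree_three_le`): D(v) ≥ ½ + ½·(Ã-legs of v) on the admissible catalogue, with
equality exactly at the vertices (1.8) with n + n′ = 1 (n̄ ≥ 1); hence (`two_deg_three_eq`, `count_le_six_of_deg_nonpos`) for
every graph with D(G) ≤ 0: (vertices) + (external φ′/A′-legs) + (Ã-legs) + 2·(external differentiations) ≤ 6 — the d = 3
content of (2.17) with the Ã-legs counted among the external legs (legend (1.17) p. 415; cf. seat p19 `B3Ineq217Concrete`).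
(3) p. 430 PROVED: two external scalar legs ⇒ ≤ 4 vertices; two external vector legs ⇒ ≤ 4 vertices; three external legs ⇒
≤ 3 vertices; four ⇒ ≤ 2 (`nV_le_four_of_two_extScalar`, `nV_le_four_of_two_extVector`, `nV_add_ext_le_six`); and, with the
one-vertex graphs treated apart (`ext_le_three_of_nV_eq_one`), at most FOUR external legs Ã included (`ext_le_four_of_deg_nonpos`,
`deg_pos_of_four_lt_ext` = Cor. 2.3 fourth clause with the Ã-legs counted).  NOT here: the pictorial enumeration (2.18)–(2.22)
(pictures), the uniqueness of the four-leg graph (2.4) (`…B3Graph24Unique`), the parity of the scalar legs p. 431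
(`…B3ScalarLegParity`), connectedness / one-particle irreducibility (not imposed by the model).
-/

namespace Literature.MathematicalPhysics.QuantumFieldTheory.Balaban1983to89.B3DivergentGraphs

open Finset B3Prop1 B3Sect2Statements B3VertexBridge B3Cor23Concrete

variable {nbar : ℕ} (G : Graph nbar)

/-! ## Leg counts of a graph of the model -/

/-- The number of external legs of scalar fields of G: the φ′-legs of its vertices not lying on internal lines (p. 414:
*"Some φ′-legs are replaced by external scalar fields and the remaining are again divided into pairs"*).
[cite: Balaban1983Higgs3, p.414] -/
def numExtScalarLegs : ℕ := ∑ i, ((G.kind i).scalarLegs - G.intScalar i)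

/-- The number of external legs of the fluctuation vector field A′ of G (A′-legs not lying on internal lines; in the
expansion itself *"All the A′-legs are contracted"*, p. 414, such legs arise when lines are replaced by external fields,
p. 432). [cite: Balaban1983Higgs3, p.414] -/
def numExtVectorLegs : ℕ := ∑ i, ((G.kind i).vectorLegs - G.intVector i)

/-- The number of legs of the external vector field Ã of G (the factors Ã(b)^{n′} of (1.8)–(1.11), (1.14)–(1.15); external
fields, drawn as external vector legs in the pictures, legend (1.17) p. 415). [cite: Balaban1983Higgs3, (1.17) p.415] -/
def numTildeLegs : ℕ := ∑ i, (G.kind i).extVectorLegs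

/-- The number of differentiations of G acting on external legs (the D^η_B̃ of (1.8)/(1.9) whose φ′-leg is not on an
internal line; dimension −1 only when *"acting on internal lines"*, (2.1) p. 422). [cite: Balaban1983Higgs3, (2.1) p.422] -/
def numExtDiffs : ℕ := ∑ i, ((G.kind i).diffCount - G.intDiffs i)

/-- kernel: the external legs of (2.17) are the external φ′-legs and the external A′-legs. [cite: Balaban1983Higgs3, (2.17) p.429] -/
theorem numExtLegs_eq_add : G.numExtLegs = numExtScalarLegs G + numExtVectorLegs G := by
  unfold Graph.numExtLegs numExtScalarLegs numExtVectorLegs Graph.extLegs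
  rw [← sum_add_distrib]

/-- kernel: external φ′-legs are external legs. [cite: Balaban1983Higgs3, (2.17) p.429] -/
theorem numExtScalarLegs_le : numExtScalarLegs G ≤ G.numExtLegs := by
  rw [numExtLegs_eq_add]; exact Nat.le_add_right _ _

/-- kernel: external A′-legs are external legs. [cite: Balaban1983Higgs3, (2.17) p.429] -/
theorem numExtVectorLegs_le : numExtVectorLegs G ≤ G.numExtLegs := by
  rw [numExtLegs_eq_add]; exact Nat.le_add_left _ _

/-! ## (2.1)/(2.2): exact bookkeeping of external legs and external differentiations -/

/-- (2.1) p. 422 rewritten, for a vertex NOT of the form (1.14)–(1.15): D_G(v) = D(v) + ext(v)·(d−2)/2 + (differentiations of v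
not acting on internal lines) — every external leg raises the all-internal degree D(v) of p. 423 by (d−2)/2 (a leg has dimension
−(d−2)/2, an external field 0) and every differentiation taken off an internal line raises it by 1. Exact form of
`B3Cor23Concrete.Facts.degree_add_ext_le_degreeIn`. [cite: Balaban1983Higgs3, (2.1) p.422] -/
theorem vertexDeg_eq_degree_add (d : ℕ) (i : Fin G.nV) (hav : (G.kind i).isAveragingVertex = false) :
    G.vertexDeg d i = degree d (toCounts d (G.kind i)) + (G.extLegs i : ℚ) * (((d : ℚ) - 2) / 2)
      + (((G.kind i).diffCount - G.intDiffs i : ℕ) : ℚ) := by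
  have h1 : (((G.kind i).scalarLegs - G.intScalar i : ℕ) : ℚ) = (G.kind i).scalarLegs - G.intScalar i :=
    Nat.cast_sub (G.intScalar_le i)
  have h2 : (((G.kind i).vectorLegs - G.intVector i : ℕ) : ℚ) = (G.kind i).vectorLegs - G.intVector i :=
    Nat.cast_sub (G.intVector_le i)
  have h3 : (((G.kind i).diffCount - G.intDiffs i : ℕ) : ℚ) = (G.kind i).diffCount - G.intDiffs i :=
    Nat.cast_sub (G.intDiffs_le i)
  rw [G.vertexDeg_eq, degree_eq]
  simp only [toCounts, hav, Bool.false_eq_true, if_false, add_zero, Graph.extLegs]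
  push_cast [h1, h2, h3]
  ring

/-- (2.2) p. 423 rewritten for a graph without vertices (1.14)–(1.15): D(G) = Σ_v D(v) + E·(d−2)/2 + (external
differentiations) − d, E = the number of external φ′/A′-legs. [cite: Balaban1983Higgs3, (2.2) p.423] -/
theorem deg_eq_sum (d : ℕ) (hav : ∀ i, (G.kind i).isAveragingVertex = false) :
    G.deg d = (∑ i, degree d (toCounts d (G.kind i))) + (G.numExtLegs : ℚ) * (((d : ℚ) - 2) / 2)
      + (numExtDiffs G : ℚ) - d := by
  rw [G.deg_eq, sum_congr rfl fun i _ => vertexDeg_eq_degree_add G d i (hav i), sum_add_distrib, sum_add_distrib,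
    ← sum_mul]
  unfold Graph.numExtLegs numExtDiffs
  push_cast
  ring

/-- kernel: a graph without vertices of the form (1.13)–(1.15) has no vertex of the form (1.14)–(1.15).
[cite: Balaban1983Higgs3, Cor. 2.3 p.429] -/
theorem isAveragingVertex_eq_false (h : ¬ G.HasVertex1315) (i : Fin G.nV) : (G.kind i).isAveragingVertex = false := by
  by_contra hc
  exact h ⟨i, Facts.isOfForm1315_of_isAveraging _ (by simpa using hc)⟩

/-- Cor. 2.3 first clause (seat p18 gen 1, `B3Cor23ConcreteProof.deg_pos_of_hasVertex1315`), contrapositive: a divergent graph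
(D(G) ≤ 0, d = 3) has no vertex of the form (1.13)–(1.15) — p. 429: *"They can be built of the vertices (1.6)–(1.8) and (1.10)
only, on the basis of the above corollary."* [cite: Balaban1983Higgs3, Cor. 2.3 p.429] -/
theorem not_hasVertex1315_of_deg_nonpos (hD : G.deg 3 ≤ 0) : ¬ G.HasVertex1315 := fun h => by
  linarith [B3Cor23ConcreteProof.deg_pos_of_hasVertex1315 G h]

/-- Cor. 2.3 second clause, contrapositive (n̄ ≥ 3; seat p18 gen 1): a divergent graph has no R-vertex.
[cite: Balaban1983Higgs3, Cor. 2.3 p.429] -/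
theorem not_hasRVertex_of_deg_nonpos (hn : 3 ≤ nbar) (hD : G.deg 3 ≤ 0) : ¬ G.HasRVertex := fun h => by
  linarith [B3Cor23ConcreteProof.deg_pos_of_hasRVertex G hn h]

/-! ## d = 3: the all-internal degree against the Ã-legs -/

/-- d = 3, table (i)–(v) p. 423 refined by the Ã-legs: every admissible catalogue vertex not of the form (1.14)–(1.15) has
D(v) ≥ ½ + ½·(number of its Ã-legs) ((iii)/(iv): D(v) = n/2 + n′ ≥ ½ + n′/2 as n + n′ ≥ 1; the R-vertices carry n′ = n̄ + 1).
[cite: Balaban1983Higgs3, p.423] -/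
theorem degree_three_ge (v : VertexKind) (hv : v.Admissible nbar) (hav : v.isAveragingVertex = false) :
    1 / 2 + (v.extVectorLegs : ℚ) / 2 ≤ degree 3 (toCounts 3 v) := by
  cases v with
  | v16 => rw [toCounts_v16, degree_v16]; simp [VertexKind.extVectorLegs]; norm_num
  | v17 => rw [toCounts_v17, degree_v17]; simp [VertexKind.extVectorLegs]; norm_num
  | v18 n n' =>
    rw [toCounts_v18, degree_v18]
    obtain ⟨-, -, h1⟩ := hv
    have h1' : (1 : ℚ) ≤ n + n' := by exact_mod_cast h1
    simp only [VertexKind.extVectorLegs]; push_cast; linarith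
  | v19 n nb =>
    rw [toCounts_v19, degree_v18]
    have : (0 : ℚ) ≤ n := Nat.cast_nonneg _
    simp only [VertexKind.extVectorLegs]; push_cast; linarith
  | v110 n n' =>
    rw [toCounts_v110, degree_v110]
    obtain ⟨-, -, -, h2⟩ := hv
    have h2' : (2 : ℚ) ≤ n + n' := by exact_mod_cast h2
    simp only [VertexKind.extVectorLegs]; push_cast; linarith
  | v111 n nb =>
    rw [toCounts_v111, degree_v110]
    have : (0 : ℚ) ≤ n := Nat.cast_nonneg _
    simp only [VertexKind.extVectorLegs]; push_cast; linarith
  | v113 => rw [degree_toCounts_v113, degree_v1315]; simp [VertexKind.extVectorLegs]; norm_num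
  | v114 n n' => simp [VertexKind.isAveragingVertex] at hav
  | v115 n nb => simp [VertexKind.isAveragingVertex] at hav

/-- d = 3, the equality case of `degree_three_ge` (n̄ ≥ 1): D(v) ≤ ½ + ½·(Ã-legs of v) forces v to be a vertex (1.8) with
n + n′ = 1 — the vertices of the graph (2.4) (p. 424) and of the lowest-order pictures (2.18)–(2.21) (pp. 429–430).
[cite: Balaban1983Higgs3, p.423] -/
theorem eq_v18_of_degree_three_le (hn : 1 ≤ nbar) (v : VertexKind) (hv : v.Admissible nbar)
    (hav : v.isAveragingVertex = false) (h : degree 3 (toCounts 3 v) ≤ 1 / 2 + (v.extVectorLegs : ℚ) / 2) :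
    ∃ n n' : ℕ, v = .v18 n n' ∧ n + n' = 1 := by
  cases v with
  | v16 => rw [toCounts_v16, degree_v16] at h; simp [VertexKind.extVectorLegs] at h; norm_num at h
  | v17 => rw [toCounts_v17, degree_v17] at h; simp [VertexKind.extVectorLegs] at h; norm_num at h
  | v18 n n' =>
    rw [toCounts_v18, degree_v18] at h
    obtain ⟨-, -, h1⟩ := hv
    simp only [VertexKind.extVectorLegs] at h; push_cast at h
    refine ⟨n, n', rfl, ?_⟩
    have : (n : ℚ) + n' ≤ 1 := by linarith
    have : n + n' ≤ 1 := by exact_mod_cast this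
    omega
  | v19 n nb =>
    rw [toCounts_v19, degree_v18] at h
    obtain ⟨hnb, -⟩ := hv
    have : (0 : ℚ) ≤ n := Nat.cast_nonneg _
    have : (1 : ℚ) ≤ nb := by rw [hnb]; exact_mod_cast hn
    simp only [VertexKind.extVectorLegs] at h; push_cast at h; linarith
  | v110 n n' =>
    rw [toCounts_v110, degree_v110] at h
    obtain ⟨-, -, -, h2⟩ := hv
    have h2' : (2 : ℚ) ≤ n + n' := by exact_mod_cast h2
    simp only [VertexKind.extVectorLegs] at h; push_cast at h; linarith
  | v111 n nb =>
    rw [toCounts_v111, degree_v110] at h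
    obtain ⟨hnb, -⟩ := hv
    have : (0 : ℚ) ≤ n := Nat.cast_nonneg _
    have : (1 : ℚ) ≤ nb := by rw [hnb]; exact_mod_cast hn
    simp only [VertexKind.extVectorLegs] at h; push_cast at h; linarith
  | v113 => rw [degree_toCounts_v113, degree_v1315] at h; simp [VertexKind.extVectorLegs] at h; norm_num at h
  | v114 n n' => simp [VertexKind.isAveragingVertex] at hav
  | v115 n nb => simp [VertexKind.isAveragingVertex] at hav

/-- d = 3, (2.2) for a graph without vertices (1.14)–(1.15), in budget form: 2·D(G) = Σ_v [2D(v) − 1 − Ã(v)] + V + E + Ã +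
2·(external differentiations) − 6, every bracket ≥ 0 (`degree_three_ge`). [cite: Balaban1983Higgs3, (2.2) p.423] -/
theorem two_deg_three_eq (hav : ∀ i, (G.kind i).isAveragingVertex = false) :
    2 * G.deg 3 = (∑ i, (2 * degree 3 (toCounts 3 (G.kind i)) - 1 - ((G.kind i).extVectorLegs : ℚ)))
      + G.nV + G.numExtLegs + numTildeLegs G + 2 * numExtDiffs G - 6 := by
  rw [deg_eq_sum G 3 hav, sum_sub_distrib, sum_sub_distrib, ← mul_sum, sum_const, card_univ, Fintype.card_fin]
  unfold numTildeLegs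
  push_cast
  ring

/-- p. 429 [PDF 19] (after Cor. 2.3): *"Now we can describe classes of divergent graphs i.e. graphs with nonpositive degree."* —
d = 3, for EVERY graph of the model with D(G) ≤ 0: (number of vertices) + (number of external φ′/A′-legs) + (number of Ã-legs)
+ 2·(differentiations on external legs) ≤ 6.  This is (2.17) in d = 3 with the Ã-legs counted among the external legs, plus the
differentiation term; vertices (1.13)–(1.15) are excluded by Cor. 2.3 (`not_hasVertex1315_of_deg_nonpos`).
[cite: Balaban1983Higgs3, (2.17) p.429] -/
theorem count_le_six_of_deg_nonpos (hD : G.deg 3 ≤ 0) :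
    G.nV + G.numExtLegs + numTildeLegs G + 2 * numExtDiffs G ≤ 6 := by
  have hav := isAveragingVertex_eq_false G (not_hasVertex1315_of_deg_nonpos G hD)
  have hid := two_deg_three_eq G hav
  have hnn : 0 ≤ ∑ i, (2 * degree 3 (toCounts 3 (G.kind i)) - 1 - ((G.kind i).extVectorLegs : ℚ)) :=
    sum_nonneg fun i _ => by linarith [degree_three_ge (G.kind i) (G.adm i) (hav i)]
  have : (G.nV + G.numExtLegs + numTildeLegs G + 2 * numExtDiffs G : ℚ) ≤ 6 := by linarith
  exact_mod_cast this

/-- d = 3, divergent graphs: V + (all external legs, Ã included) ≤ 6. [cite: Balaban1983Higgs3, (2.17) p.429] -/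
theorem nV_add_ext_le_six (hD : G.deg 3 ≤ 0) : G.nV + (G.numExtLegs + numTildeLegs G) ≤ 6 := by
  have := count_le_six_of_deg_nonpos G hD; omega

/-! ## p. 430: graphs with two external legs have at most four vertices -/

/-- p. 430 [PDF 20], verbatim: *"The next class of graphs is formed by graphs with two external scalar field legs. The estimate
(2.17) implies that we can have such graphs with at most four vertices."* — PROVED (d = 3) for every graph of the model with
D(G) ≤ 0 and two external φ′-legs (whatever its other legs). [cite: Balaban1983Higgs3, p.430] -/
theorem nV_le_four_of_two_extScalar (hD : G.deg 3 ≤ 0) (h2 : numExtScalarLegs G = 2) : G.nV ≤ 4 := by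
  have := count_le_six_of_deg_nonpos G hD
  have := numExtScalarLegs_le G
  omega

/-- p. 430 [PDF 20], verbatim: *"There is a similar class of graphs with two external vector field legs, and these graphs have
at most four vertices again."* — PROVED (d = 3) for every graph of the model with D(G) ≤ 0 and two external vector legs, the
external vector legs being the Ã-legs and the uncontracted A′-legs. [cite: Balaban1983Higgs3, p.430] -/
theorem nV_le_four_of_two_extVector (hD : G.deg 3 ≤ 0) (h2 : numExtVectorLegs G + numTildeLegs G = 2) : G.nV ≤ 4 := by
  have := count_le_six_of_deg_nonpos G hD
  have := numExtVectorLegs_le G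
  omega

/-- p. 429 [PDF 19]: *"There are many graphs with three external legs and they fall into two classes"* — d = 3: a divergent graph
with at least three external legs (Ã included) has at most three vertices (the pictures (2.18)–(2.21) have two or three).
[cite: Balaban1983Higgs3, (2.18)–(2.21) pp.429–430] -/
theorem nV_le_three_of_three_ext (hD : G.deg 3 ≤ 0) (h3 : 3 ≤ G.numExtLegs + numTildeLegs G) : G.nV ≤ 3 := by
  have := count_le_six_of_deg_nonpos G hD; omega

/-- p. 429 [PDF 19]: *"There is only one graph with four external legs and it is the graph (2.4)"* — counting half, d = 3: a
divergent graph with four external legs (Ã included) has at most two vertices and no differentiation on an external leg (the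
graph itself is identified in `…B3Graph24Unique`). [cite: Balaban1983Higgs3, (2.4) p.429] -/
theorem nV_le_two_of_four_ext (hD : G.deg 3 ≤ 0) (h4 : G.numExtLegs + numTildeLegs G = 4) :
    G.nV ≤ 2 ∧ numExtDiffs G = 0 := by
  have := count_le_six_of_deg_nonpos G hD
  have hV : 1 ≤ G.nV := by obtain ⟨x, -⟩ := G.exists_line; exact Fin.pos x.1
  omega

/-- d = 3 catalogue fact for a lone vertex: an admissible vertex not of the form (1.14)–(1.15) with at least two legs on internal
lines (a line with both endpoints at the vertex) and D(v) + ext/2 ≤ 3 has ext + (Ã-legs) ≤ 3 ((iii)/(iv) p. 423: D(v) = n/2 + n′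
and ext ≤ n). [cite: Balaban1983Higgs3, p.423] -/
theorem ext_add_tilde_le_three (v : VertexKind) (hv : v.Admissible nbar) (hav : v.isAveragingVertex = false) (ext : ℕ)
    (hlegs : ext + 2 ≤ v.scalarLegs + v.vectorLegs) (hdeg : degree 3 (toCounts 3 v) + (ext : ℚ) / 2 ≤ 3) :
    ext + v.extVectorLegs ≤ 3 := by
  cases v with
  | v16 => simp [VertexKind.scalarLegs, VertexKind.vectorLegs, VertexKind.extVectorLegs] at hlegs ⊢; omega
  | v17 => simp [VertexKind.scalarLegs, VertexKind.vectorLegs, VertexKind.extVectorLegs] at hlegs ⊢; omega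
  | v18 n n' =>
    rw [toCounts_v18, degree_v18] at hdeg
    simp only [VertexKind.scalarLegs, VertexKind.vectorLegs, VertexKind.extVectorLegs] at hlegs ⊢
    have : (ext : ℚ) ≤ n := by exact_mod_cast (show ext ≤ n by omega)
    have : (ext : ℚ) + n' ≤ 3 := by push_cast at hdeg; linarith
    exact_mod_cast this
  | v19 n nb =>
    rw [toCounts_v19, degree_v18] at hdeg
    simp only [VertexKind.scalarLegs, VertexKind.vectorLegs, VertexKind.extVectorLegs] at hlegs ⊢
    have : (ext : ℚ) ≤ n := by exact_mod_cast (show ext ≤ n by omega)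
    have : (ext : ℚ) + (nb + 1) ≤ 3 := by push_cast at hdeg; linarith
    exact_mod_cast this
  | v110 n n' =>
    rw [toCounts_v110, degree_v110] at hdeg
    simp only [VertexKind.scalarLegs, VertexKind.vectorLegs, VertexKind.extVectorLegs] at hlegs ⊢
    have : (ext : ℚ) ≤ n := by exact_mod_cast (show ext ≤ n by omega)
    have : (ext : ℚ) + n' ≤ 3 := by push_cast at hdeg; linarith
    exact_mod_cast this
  | v111 n nb =>
    rw [toCounts_v111, degree_v110] at hdeg
    simp only [VertexKind.scalarLegs, VertexKind.vectorLegs, VertexKind.extVectorLegs] at hlegs ⊢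
    have : (ext : ℚ) ≤ n := by exact_mod_cast (show ext ≤ n by omega)
    have : (ext : ℚ) + (nb + 1) ≤ 3 := by push_cast at hdeg; linarith
    exact_mod_cast this
  | v113 => simp [VertexKind.scalarLegs, VertexKind.vectorLegs] at hlegs
  | v114 n n' => simp [VertexKind.isAveragingVertex] at hav
  | v115 n nb => simp [VertexKind.isAveragingVertex] at hav

/-- kernel: a vertex carrying two distinct internal φ′-legs has at least two. [cite: Balaban1983Higgs3, (2.1) p.422] -/
theorem two_le_intScalar {i : Fin G.nV} (j j' : Fin (G.kind i).scalarLegs) (hne : j ≠ j')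
    (h : (G.other ⟨i, .inl j⟩).isSome) (h' : (G.other ⟨i, .inl j'⟩).isSome) : 2 ≤ G.intScalar i :=
  one_lt_card_iff.mpr ⟨j, j', by simpa using h, by simpa using h', hne⟩

/-- kernel: a one-vertex graph of the model has a line with both endpoints at its vertex, hence at least two internal legs there
(p. 415: *"There is at least one internal line, and every internal line has a vertex at each endpoint"*).
[cite: Balaban1983Higgs3, p.415] -/
theorem two_le_int_of_subsingleton (hsub : ∀ i j : Fin G.nV, i = j) (i : Fin G.nV) :
    2 ≤ G.intScalar i + G.intVector i := by
  obtain ⟨⟨i₀, y⟩, hy⟩ := G.exists_line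
  obtain rfl := hsub i₀ i
  obtain ⟨z, hz⟩ := Option.isSome_iff_exists.mp hy
  cases y with
  | inl j =>
    obtain ⟨i', j', rfl, hz'⟩ := G.other_scalar hz
    obtain rfl := hsub i' i₀
    have hne : j ≠ j' := by rintro rfl; exact G.other_ne _ _ hz rfl
    have := two_le_intScalar G j j' hne hy (by simp [hz'])
    omega
  | inr j =>
    obtain ⟨i', j', rfl, hz'⟩ := G.other_vector hz
    obtain rfl := hsub i' i₀
    have hne : j ≠ j' := by rintro rfl; exact G.other_ne _ _ hz rfl
    have := G.two_le_intVector j j' hne hy (by simp [hz'])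
    omega

/-- d = 3: a divergent ONE-VERTEX graph (a vertex with lines returning to it) has at most three external legs, Ã included
(the vertices (1.8)–(1.11) with a tadpole: ext ≤ n and D(v) = n/2 + n′ ≤ 3 − ext/2). [cite: Balaban1983Higgs3, p.423] -/
theorem ext_le_three_of_nV_eq_one (hD : G.deg 3 ≤ 0) (hV : G.nV = 1) : G.numExtLegs + numTildeLegs G ≤ 3 := by
  have hav := isAveragingVertex_eq_false G (not_hasVertex1315_of_deg_nonpos G hD)
  have hsub : ∀ i j : Fin G.nV, i = j := fun i j => Fin.ext (by omega)
  obtain ⟨⟨i₀, -⟩, -⟩ := G.exists_line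
  have huniv : (univ : Finset (Fin G.nV)) = {i₀} := by ext i; simp [hsub i i₀]
  have hE : G.numExtLegs = G.extLegs i₀ := by simp [Graph.numExtLegs, huniv]
  have hT : numTildeLegs G = (G.kind i₀).extVectorLegs := by simp [numTildeLegs, huniv]
  have hint := two_le_int_of_subsingleton G hsub i₀
  have hlegs : G.extLegs i₀ + 2 ≤ (G.kind i₀).scalarLegs + (G.kind i₀).vectorLegs := by
    have := G.intScalar_le i₀; have := G.intVector_le i₀; unfold Graph.extLegs; omega
  have hdeg : degree 3 (toCounts 3 (G.kind i₀)) + (G.extLegs i₀ : ℚ) / 2 ≤ 3 := by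
    have h1 := vertexDeg_eq_degree_add G 3 i₀ (hav i₀)
    have h2 : G.deg 3 = G.vertexDeg 3 i₀ - 3 := by rw [G.deg_eq]; simp [huniv]
    have h3 : (0 : ℚ) ≤ (((G.kind i₀).diffCount - G.intDiffs i₀ : ℕ) : ℚ) := Nat.cast_nonneg _
    push_cast at h1
    linarith
  rw [hE, hT]
  exact ext_add_tilde_le_three (G.kind i₀) (G.adm i₀) (hav i₀) (G.extLegs i₀) hlegs hdeg

/-- d = 3: a divergent graph has at most four external legs, the Ã-legs counted — Cor. 2.3 fourth clause (*"or it has more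
than four external legs, then D(G) > 0"*) strengthened by the Ã-legs of legend (1.17). [cite: Balaban1983Higgs3, Cor. 2.3 p.429] -/
theorem ext_le_four_of_deg_nonpos (hD : G.deg 3 ≤ 0) : G.numExtLegs + numTildeLegs G ≤ 4 := by
  have := count_le_six_of_deg_nonpos G hD
  have hV : 1 ≤ G.nV := by obtain ⟨x, -⟩ := G.exists_line; exact Fin.pos x.1
  by_cases h1 : G.nV = 1
  · have := ext_le_three_of_nV_eq_one G hD h1; omega
  · omega

/-- Cor. 2.3 fourth clause with the Ã-legs counted (d = 3): more than four external legs ⇒ D(G) > 0.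
[cite: Balaban1983Higgs3, Cor. 2.3 p.429] -/
theorem deg_pos_of_four_lt_ext (h : 4 < G.numExtLegs + numTildeLegs G) : 0 < G.deg 3 := by
  by_contra hD
  push Not at hD
  have := ext_le_four_of_deg_nonpos G hD
  omega

end Literature.MathematicalPhysics.QuantumFieldTheory.Balaban1983to89.B3DivergentGraphs
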